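import Literature.NumberTheory.GaloisCohomology.CorrectionAtPOfCharacterReal
import Literature.NumberTheory.GaloisCohomology.ArchimedeanInvariantMapLevelChange
import Literature.NumberTheory.GaloisCohomology.ArtinMapInfiniteIdelesSplit
import Literature.NumberTheory.GaloisCohomology.BrauerSumInvCyclicClassArchimedean
import Literature.NumberTheory.GaloisCohomology.CyclotomicCharacterPPrimary
import HarnessLib

/-!
# The correction at one real place (Tate's reciprocity law, `2`-primary part over fields with real places)

Let `K` be a number field with a real place `w₀` and `n` an even level.  This file constructs a class
`x ∈ H²(Γ_K, μₙ)` with archimedean invariant `inv_{w₀}(loc_{w₀} x) = n/2` at `w₀`, VANISHING at every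
other real place, with finitely supported local invariants summing to zero over every large finite set
of places — the elementary "correction at a real place" by which a class of `H²(Γ_K, μ_{2^k})` is made
to vanish at the real places before Tate's cyclotomic killing (Cassels–Fröhlich VII §11: over a field
with real places the auxiliary cyclic extensions must be taken complex; here `K(ζ₃) ⊇ K(√-3)`).

Construction: `x = ι_*(κ₂(b) ∪ ψ₂)` where `ψ₂ : Γ_K ↠ ℤ/2` is the quadratic character of `K(√-3)/K`
(`σ ↦ [σ ζ₃ = ζ₃⁻¹]`, through the tree's `modNCyclotomicCharacter K 3`; non-trivial on every complex
conjugation), `b ∈ Kˣ` is negative at `w₀`, positive at the other real places and `≡ 1` above `3`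
(`exists_valuation_sub_one_lt_and_forall_isReal_sign`), and `ι : μ₂ ⊆ μₙ`.  The invariants:
at `w₀`, `ψ₂(c_{w₀}) = 1` read at level `n` is `n/2` (`archimedeanInvariantMap_localization_cupProduct_δ₀_of_neg`,
`archimedeanInvariantMap_localization_cohomologyMap_muInclHom`); at the other real places `0` (`b >_w 0`);
at the finite places `ψ₂(Frob_v)·ord_v(b)` off `3` and `0` above `3` (Hensel); and the total over all
places is `−ψ₂(γ) + 1 = 0` with `γ` a lift of `ψ_{L|K}((b)_∞) = c_{w₀}|_L`
(`sum_localInvariantMap_localization_cupProduct_δ₀_eq_neg_apply`, `artinIdeleMap_infiniteIdeleSingle_neg_one`).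

* `exists_cyclicCharacter_two_cyclotomic_three` — the quadratic character `ψ₂`;
* **`exists_realCorrection_single`** — the class `x`.

Node (N5a) of the `∀ K` form of `poitouTate_sum_localTatePairing_eq_zero` (cell `bsd-cn100`, seat
transfer-2 g5).  Proof file: theorems only (no definition, no named fact, no instance; D-0026).

## References

* J. Tate, *Global class field theory*, Ch. VII of Cassels–Fröhlich (1967), §11 (the reciprocity law;
  complex cyclic cyclotomic auxiliary fields). [CasselsFrohlichANT1967]
* J.-P. Serre, *Corps locaux* (1979), XIV §1 Prop. 3. [SerreLocalFields1979]
* J. Neukirch, *Algebraic Number Theory* (1999), Ch. VI §5 (5.6). [NeukirchANT1999]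
-/

noncomputable section

open CategoryTheory Function Field NumberField IsDedekindDomain
open scoped NumberField

namespace Literature.NumberTheory.GaloisCohomology

open _root_.ContinuousCohomology
open Literature.NumberTheory.GaloisRepresentations
open Literature.NumberTheory.GaloisRepresentations.DiscreteGaloisModule
open Literature.NumberTheory.GaloisRepresentations.LocalWeilDatum
open Literature.NumberTheory.NumberFields
open Literature.NumberTheory.Automorphic
open Literature.AnabelianGeometry.AbsoluteAnabelian
open Literature.AnabelianGeometry.AbsoluteAnabelian.Prop121vii

variable (K : Type) [Field K] [NumberField K]

/-! ### §1. The quadratic character of `K(√-3)/K` -/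

/-- The units of `ℤ/3` are `±1`. [folklore] -/
private theorem units_zmod_three (u : (ZMod 3)ˣ) : u = 1 ∨ u = -1 := by
  haveI : Fact (Nat.Prime 3) := ⟨by norm_num⟩
  have hcard : Fintype.card (ZMod 3)ˣ = 2 := by rw [ZMod.card_units_eq_totient]; decide
  have hu : u ^ 2 = 1 := by rw [← hcard]; exact pow_card_eq_one
  have h' : (u : ZMod 3) * (u : ZMod 3) = 1 := by
    rw [← pow_two, ← Units.val_pow_eq_pow_val, hu, Units.val_one]
  rcases mul_self_eq_one_iff.mp h' with h'' | h''
  · exact Or.inl (Units.ext h'')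
  · exact Or.inr (Units.ext (by rw [h'', Units.val_neg, Units.val_one]))

/-- A primitive cube root of unity is not its own inverse. [folklore] -/
private theorem inv_ne_self_of_isPrimitiveRoot_three {F : Type*} [Field F] {ζ : F} (hζ : IsPrimitiveRoot ζ 3) :
    ζ⁻¹ ≠ ζ := by
  intro h
  have h2 : ζ ^ 2 = 1 := by
    rw [pow_two]
    nth_rewrite 1 [← h]
    exact inv_mul_cancel₀ (hζ.ne_zero (by norm_num))
  have := hζ.dvd_of_pow_eq_one 2 h2
  omega

omit [NumberField K] in
/-- An element of `Γ_K` moving a cube root of unity has non-trivial mod-`3` cyclotomic character.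
[folklore] -/
private theorem modNCyclotomicCharacter_three_ne_one [NeZero ((3 : ℕ) : K)] {σ : absoluteGaloisGroup K}
    {ζ : AlgebraicClosure K} (hζ3 : ζ ^ 3 = 1) (hσ : σ • ζ ≠ ζ) : modNCyclotomicCharacter K 3 σ ≠ 1 := by
  intro h1
  have hmem : σ ∈ (modNCyclotomicCharacter K 3).ker := h1
  rw [← rootsOfUnityFixer_eq_ker, mem_rootsOfUnityFixer_iff] at hmem
  exact hσ (hmem ζ hζ3)

/-- **The quadratic character of `K(√-3) = K(ζ₃)⁺-complement`**: for a number field `K` with a real place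
there is a cyclic character `ψ : Γ_K ↠ ℤ/2` — `σ ↦ 0` if `σ` fixes the cube roots of unity, `1`
otherwise (the mod-`3` cyclotomic character followed by `(ℤ/3)ˣ ≅ ℤ/2`) — cutting out a finite abelian
`L ⊆ K̄`, UNRAMIFIED AWAY FROM `3`, and NON-TRIVIAL ON EVERY COMPLEX CONJUGATION (a complex conjugation
inverts `ζ₃ ≠ ζ₃⁻¹`): on the non-trivial element of every `Γ_{K_w}`, `w` real, and on every complex
conjugation of `Γ_K` at a real place. [cite: NeukirchANT1999, Ch. VI §5 Prop. (5.6)]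
[cite: CasselsFrohlichANT1967, Ch. VII §11] -/
theorem exists_cyclicCharacter_two_cyclotomic_three {w₀ : InfinitePlace K} (hw₀ : w₀.IsReal) :
    ∃ (ψ : CyclicCharacter (absoluteGaloisGroup K) 2) (L : IntermediateField K (AlgebraicClosure K))
      (_ : FiniteDimensional K L) (_ : IsAbelianGalois K L),
      ψ.ker = galFixing K L ∧
      (∀ v : HeightOneSpectrum (𝓞 K), ((3 : ℕ) : 𝓞 K) ∉ v.asIdeal →
        ∀ σ ∈ absInertia (v.adicCompletion K), ψ (absGaloisRestrict K (v.adicCompletion K) σ) = 0) ∧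
      (∀ (w : InfinitePlace K) (c : absoluteGaloisGroup (Place.Completion (K := K) (Sum.inl w))), c ≠ 1 →
        ψ (absGaloisRestrict K (Place.Completion (K := K) (Sum.inl w)) c) = 1) ∧
      (∀ (w : InfinitePlace K) (hw : w.IsReal) (c : absoluteGaloisGroup K), IsComplexConjugationAt hw c → ψ c = 1) := by
  classical
  haveI : NeZero ((3 : ℕ) : K) := ⟨by exact_mod_cast (three_ne_zero : (3 : K) ≠ 0)⟩
  set χ := modNCyclotomicCharacter K 3 with hχ
  -- a primitive cube root of unity
  haveI : NeZero ((3 : ℕ) : AlgebraicClosure K) := NeZero.nat_of_injective (algebraMap K (AlgebraicClosure K)).injective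
  obtain ⟨ζ, hζ⟩ := HasEnoughRootsOfUnity.exists_primitiveRoot (AlgebraicClosure K) 3
  have hζ3 : ζ ^ 3 = 1 := hζ.pow_eq_one
  -- the function
  let f : absoluteGaloisGroup K → ZMod 2 := fun σ => if χ σ = 1 then 0 else 1
  have hf : ∀ σ, f σ = if χ σ = 1 then 0 else 1 := fun _ => rfl
  have hm1 : (-1 : (ZMod 3)ˣ) ≠ 1 := by decide
  have hfneg : ∀ σ, χ σ = -1 → f σ = 1 := fun σ h => by rw [hf, if_neg (by rw [h]; exact hm1)]
  have hmul : ∀ σ τ, f (σ * τ) = f σ + f τ := by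
    intro σ τ
    rcases units_zmod_three (χ σ) with hσ | hσ <;> rcases units_zmod_three (χ τ) with hτ | hτ
    · rw [hf (σ * τ), map_mul, hσ, hτ, one_mul, if_pos rfl, hf, hσ, if_pos rfl, hf, hτ, if_pos rfl, add_zero]
    · rw [hfneg _ (by rw [map_mul, hσ, hτ, one_mul]), hf σ, hσ, if_pos rfl, hfneg τ hτ, zero_add]
    · rw [hfneg _ (by rw [map_mul, hσ, hτ, mul_one]), hfneg σ hσ, hf τ, hτ, if_pos rfl, add_zero]
    · rw [hf (σ * τ), map_mul, hσ, hτ, if_pos (by rw [neg_mul_neg, one_mul]), hfneg σ hσ, hfneg τ hτ]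
      decide
  -- `f` only depends on `χ`, hence is locally constant
  have hfχ : ∀ σ τ, χ σ = χ τ → f σ = f τ := fun σ τ h => by rw [hf, hf, h]
  have hlc : IsLocallyConstant f := by
    refine (IsLocallyConstant.iff_exists_open _).mpr fun σ => ?_
    refine ⟨(fun x => σ⁻¹ * x) ⁻¹' (rootsOfUnityFixer K 3 : Set (absoluteGaloisGroup K)),
      (isOpen_rootsOfUnityFixer K 3).preimage (by fun_prop), ?_, fun x hx => ?_⟩
    · change σ⁻¹ * σ ∈ rootsOfUnityFixer K 3
      rw [inv_mul_cancel]
      exact one_mem _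
    · change σ⁻¹ * x ∈ rootsOfUnityFixer K 3 at hx
      rw [rootsOfUnityFixer_eq_ker, MonoidHom.mem_ker, map_mul, map_inv, inv_mul_eq_one] at hx
      exact hfχ x σ hx.symm
  -- complex conjugations move `ζ₃`
  have hreal : ∀ (w : InfinitePlace K) (c : absoluteGaloisGroup (Place.Completion (K := K) (Sum.inl w))),
      c ≠ 1 → f (absGaloisRestrict K (Place.Completion (K := K) (Sum.inl w)) c) = 1 := by
    intro w c hc
    rw [hf, if_neg]
    refine modNCyclotomicCharacter_three_ne_one K hζ3 ?_
    have h := absGaloisRestrict_smul_eq_inv_of_pow_eq_one_infinitePlace w hc three_ne_zero hζ3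
    exact fun heq => inv_ne_self_of_isPrimitiveRoot_three hζ (h.symm.trans heq)
  have hconj : ∀ (w : InfinitePlace K) (hw : w.IsReal) (c : absoluteGaloisGroup K),
      IsComplexConjugationAt hw c → f c = 1 := by
    intro w hw c hc
    rw [hf, if_neg]
    refine modNCyclotomicCharacter_three_ne_one K hζ3 fun hfix => ?_
    obtain ⟨ι, -, hι⟩ := isComplexConjugationAt_iff hw c |>.mp hc
    have h1 : starRingEnd ℂ (ι ζ) = ι ζ := by
      have h := hι.eq ζ
      rw [show absoluteGaloisGroup.toAlgEquiv K c ζ = c • ζ from rfl, hfix] at h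
      exact (starRingEnd_apply (R := ℂ) (ι ζ)).trans h.symm
    obtain ⟨r, hr⟩ := Complex.conj_eq_iff_real.mp h1
    have hr3 : r ^ 3 = 1 := by
      have h := congrArg ι hζ3
      rw [map_pow, map_one, hr, ← Complex.ofReal_pow] at h
      exact_mod_cast h
    have hr0 : 0 ≤ r := by
      by_contra hneg
      push Not at hneg
      have : r ^ 3 < 0 := Odd.pow_neg (by decide) hneg
      linarith
    have hr1 : r = 1 := (pow_eq_one_iff_of_nonneg hr0 (by norm_num)).mp hr3
    rw [hr1, Complex.ofReal_one, ← map_one ι] at hr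
    exact hζ.ne_one (by norm_num) (ι.injective hr)
  -- surjectivity: the complex conjugation at `w₀`
  obtain ⟨c₀, hc₀⟩ := exists_ne_one_absoluteGaloisGroup_of_isReal (K := K) hw₀
  have hsurj : Surjective f := by
    intro a
    fin_cases a
    · refine ⟨1, ?_⟩
      rw [hf, map_one, if_pos rfl]
      rfl
    · refine ⟨_, (hreal w₀ c₀ hc₀).trans ?_⟩
      rfl
  let ψ : CyclicCharacter (absoluteGaloisGroup K) 2 :=
    { toFun := f
      map_mul' := hmul
      continuous_toFun := hlc.continuous
      surjective' := hsurj }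
  have hψ : ∀ σ, ψ σ = f σ := fun _ => rfl
  obtain ⟨L, hL1, hL2, hker⟩ := CyclicCharacter.exists_ker_eq_galFixing ψ
  refine ⟨ψ, L, hL1, hL2, hker, fun v hv σ hσ => ?_, fun w c hc => hreal w c hc, fun w hw c hc => hconj w hw c hc⟩
  rw [hψ, hf, if_pos (modNCyclotomicCharacter_absGaloisRestrict_eq_one_of_mem_absInertia K 3 v hv hσ)]

/-! ### §2. The correction class at one real place -/

/-- **The correction class at a real place `w₀`** (even level `n`): a class `x ∈ H²(Γ_K, μₙ)` with
`inv_{w₀} (loc_{w₀} x) = n/2`, `loc_w x = 0` at every other real place `w`, local invariants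
supported in a finite set `S₀` of places and summing to zero over every finite `T ⊇ S₀` — see the module
docstring for the construction `x = ι_*(κ₂(b) ∪ ψ₂)` and the evaluation of its invariants.
[cite: CasselsFrohlichANT1967, Ch. VII §11] [cite: SerreLocalFields1979, XIV §1 Prop. 3] -/
theorem exists_realCorrection_single {n : ℕ} [NeZero n] (h2n : 2 ∣ n) {w₀ : InfinitePlace K}
    (hw₀ : w₀.IsReal) :
    haveI : CompactSpace (absoluteGaloisGroup K) := absoluteGaloisGroup_compactSpace K
    haveI : CompactSpace (absoluteGaloisGroup (Place.Completion (K := K) (Sum.inl w₀))) :=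
      absoluteGaloisGroup_compactSpace _
    ∃ x : galoisCohomology (mu K n) 2,
      archimedeanInvariantMap K n w₀ (galoisCohomology.localization (mu K n) (Sum.inl w₀) 2 x) =
          ((n / 2 : ℕ) : ZMod n) ∧
      (∀ w : InfinitePlace K, w.IsReal → w ≠ w₀ →
        haveI : CompactSpace (absoluteGaloisGroup (Place.Completion (K := K) (Sum.inl w))) :=
          absoluteGaloisGroup_compactSpace _
        galoisCohomology.localization (mu K n) (Sum.inl w) 2 x = 0) ∧
      ∃ S₀ : Finset (Place K),
        (∀ v ∉ S₀, LocalInvariants.canonical K n v (galoisCohomology.localization (mu K n) v 2 x) = 0) ∧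
        ∀ T : Finset (Place K), S₀ ⊆ T →
          ∑ v ∈ T, LocalInvariants.canonical K n v (galoisCohomology.localization (mu K n) v 2 x) = 0 := by
  classical
  haveI : CompactSpace (absoluteGaloisGroup K) := absoluteGaloisGroup_compactSpace K
  haveI : CompactSpace (absoluteGaloisGroup (Place.Completion (K := K) (Sum.inl w₀))) :=
    absoluteGaloisGroup_compactSpace _
  haveI : Fact (1 < 2) := ⟨one_lt_two⟩
  have hn2 : 2 * (n / 2) = n := Nat.mul_div_cancel' h2n
  -- the quadratic character and the places above `3`
  obtain ⟨ψ, L, hLfin, hLab, hker, hunr, hcval, hconj⟩ := exists_cyclicCharacter_two_cyclotomic_three K hw₀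
  haveI := hLfin
  haveI := hLab
  haveI : NumberField L := NumberField.of_module_finite K L
  have h30 : (((3 : ℕ) : 𝓞 K) : K) ≠ 0 := by exact_mod_cast (three_ne_zero : (3 : K) ≠ 0)
  set Q : Finset (HeightOneSpectrum (𝓞 K)) :=
    (finite_setOf_valued_ne_one (Units.mk0 (((3 : ℕ) : 𝓞 K) : K) h30)).toFinset with hQdef
  have hQmem : ∀ v : HeightOneSpectrum (𝓞 K), v ∈ Q ↔ ((3 : ℕ) : 𝓞 K) ∈ v.asIdeal := by
    intro v
    rw [hQdef, Set.Finite.mem_toFinset, Set.mem_setOf_eq, Units.val_mk0,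
      GaloisRepresentations.valued_algebraMap_adicCompletion,
      ← HeightOneSpectrum.valuation_lt_one_iff_mem (K := K), lt_iff_le_and_ne]
    exact ⟨fun h => ⟨HeightOneSpectrum.valuation_le_one v _, h⟩, fun h => h.2⟩
  -- the element `b`: negative at `w₀` only, `≡ 1` above `3`
  obtain ⟨b, hb0, hbQ, hbsign⟩ := exists_valuation_sub_one_lt_and_forall_isReal_sign K Q {w₀}
  have hbneg : InfinitePlace.Completion.extensionEmbeddingOfIsReal hw₀ (algebraMap K w₀.Completion b) < 0 :=
    (hbsign w₀ hw₀).1 (Set.mem_singleton w₀)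
  have hbpos : ∀ (w : InfinitePlace K) (hw : w.IsReal), w ≠ w₀ →
      0 < InfinitePlace.Completion.extensionEmbeddingOfIsReal hw (algebraMap K w.Completion b) :=
    fun w hw hne => (hbsign w hw).2 (by rwa [Set.mem_singleton_iff])
  -- the class `x₂ = κ₂(b) ∪ ψ` and `x = ι_* x₂`
  set x₂ : galoisCohomology (mu K 2) 2 := ((mu K 2).tateDualPairing 2).cupProduct
      ((isSES_kummer K 2 (NeZero.pos _)).δ₀ (baseUnitsInvariant K b hb0))
      (oneCocycleClass _ (scalarCocycle ψ)) with hx₂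
  set x : galoisCohomology (mu K n) 2 := cohomologyMap (muInclHom K h2n) 2 x₂ with hx
  obtain ⟨c₀, hc₀⟩ := exists_ne_one_absoluteGaloisGroup_of_isReal (K := K) hw₀
  -- the archimedean invariants of `x₂`
  have hinf₀ : archimedeanInvariantMap K 2 w₀ (galoisCohomology.localization (mu K 2) (Sum.inl w₀) 2 x₂) = 1 := by
    rw [hx₂, archimedeanInvariantMap_localization_cupProduct_δ₀_of_neg hw₀ ψ b hb0 hbneg hc₀, hcval w₀ c₀ hc₀]
  have hinf : ∀ w : InfinitePlace K, w.IsReal → w ≠ w₀ →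
      haveI : CompactSpace (absoluteGaloisGroup (Place.Completion (K := K) (Sum.inl w))) :=
        absoluteGaloisGroup_compactSpace _
      galoisCohomology.localization (mu K 2) (Sum.inl w) 2 x₂ = 0 := fun w hw hne =>
    localization_inl_cupProduct_δ₀_eq_zero_of_pos hw b hb0 (hbpos w hw hne) _
  -- the finite invariants of `x₂`: `f_v · ord_v(b)` off `3`, `0` above `3`
  have hfin : ∀ v : HeightOneSpectrum (𝓞 K), v ∉ Q → ∃ f : ℕ,
      localInvariantMap K 2 v (galoisCohomology.localization (mu K 2) (Sum.inr v) 2 x₂) =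
        (f : ZMod 2) * (ord (v.adicCompletion K) (algebraMap K (v.adicCompletion K) b) : ZMod 2) := by
    intro v hvQ
    haveI : CharZero (v.adicCompletion K) := charZero_adicCompletion v
    obtain ⟨ψE, hIE, hFE, -, -⟩ := exists_normalizedCharacter (v.adicCompletion K) 2 one_lt_two
    obtain ⟨f, hψf, -⟩ := exists_apply_absGaloisRestrict_eq_mul (v.adicCompletion K) ψ
      (hunr v (by rwa [← hQmem])) ψE hIE hFE
    exact ⟨f, by rw [hx₂]; exact localInvariantMap_localization_cupProduct_δ₀ v ψ ψE hIE hFE hψf b hb0⟩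
  have hQ2 : ∀ v ∈ Q, ((2 : ℕ) : 𝓞 K) ∉ v.asIdeal := by
    intro v hv h2
    have h3 : ((3 : ℕ) : 𝓞 K) ∈ v.asIdeal := (hQmem v).mp hv
    have h1 : (1 : 𝓞 K) ∈ v.asIdeal := by
      have : (1 : 𝓞 K) = ((3 : ℕ) : 𝓞 K) - ((2 : ℕ) : 𝓞 K) := by push_cast; norm_num
      rw [this]
      exact v.asIdeal.sub_mem h3 h2
    exact v.isPrime.ne_top ((Ideal.eq_top_iff_one _).mpr h1)
  have hlocQ : ∀ v ∈ Q, galoisCohomology.localization (mu K 2) (Sum.inr v) 2 x₂ = 0 := fun v hv => by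
    rw [hx₂]
    exact localization_cupProduct_δ₀_eq_zero_of_valuation_sub_one_lt v (hQ2 v hv) b hb0 (hbQ v hv) _
  set Sb : Finset (HeightOneSpectrum (𝓞 K)) := (finite_setOf_valued_ne_one (Units.mk0 b hb0)).toFinset with hSb
  have hinv0 : ∀ v ∉ Q ∪ Sb, localInvariantMap K 2 v (galoisCohomology.localization (mu K 2) (Sum.inr v) 2 x₂) = 0 := by
    intro v hv
    rw [Finset.notMem_union] at hv
    have hval : Valued.v (algebraMap K (v.adicCompletion K) b) = 1 := by
      by_contra h
      exact hv.2 ((finite_setOf_valued_ne_one (Units.mk0 b hb0)).mem_toFinset.mpr h)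
    have hord : ord (v.adicCompletion K) (algebraMap K (v.adicCompletion K) b) = 0 :=
      ord_adicCompletion_eq_of_valued_eq v ((map_ne_zero_iff _ (algebraMap K _).injective).2 hb0)
        (e := 0) (by rw [hval, neg_zero, WithZero.exp_zero])
    obtain ⟨f, hf⟩ := hfin v hv.1
    rw [hf, hord, Int.cast_zero, mul_zero]
  -- the support `S₀`: the places above `3`, the support of `b`, and all infinite places
  set S₀ : Finset (Place K) := (Q ∪ Sb).map ⟨Sum.inr, Sum.inr_injective⟩ ∪
    (Finset.univ : Finset (InfinitePlace K)).map ⟨Sum.inl, Sum.inl_injective⟩ with hS₀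
  have hS₀inl : ∀ w : InfinitePlace K, (Sum.inl w : Place K) ∈ S₀ := fun w =>
    Finset.mem_union_right _ (Finset.mem_map.mpr ⟨w, Finset.mem_univ w, rfl⟩)
  have hS₀inr : ∀ v : HeightOneSpectrum (𝓞 K), (Sum.inr v : Place K) ∉ S₀ → v ∉ Q ∪ Sb := by
    intro v hv h
    exact hv (Finset.mem_union_left _ (Finset.mem_map.mpr ⟨v, h, rfl⟩))
  -- level-`2` invariants of `x₂` vanish off `S₀`
  have hcan0 : ∀ v ∉ S₀, LocalInvariants.canonical K 2 v (galoisCohomology.localization (mu K 2) v 2 x₂) = 0 := by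
    intro v hv
    rcases v with w | v
    · exact absurd (hS₀inl w) hv
    · rw [LocalInvariants.canonical_inr]
      exact hinv0 v (hS₀inr v hv)
  -- the Artin symbol of `(b)_∞` is `c_{w₀}|_L`
  obtain ⟨c', hc'⟩ : ∃ c' : absoluteGaloisGroup K, IsComplexConjugationAt hw₀ c' :=
    Literature.NumberTheory.GaloisRepresentations.exists_isComplexConjugation (K := K)
      (NumberField.InfinitePlace.embedding_of_isReal hw₀)
  have hγ : absRestrictNormalHom L c'⁻¹ = artinIdeleMap L artinReciprocity_character_holds
      (infiniteIdeles K (globalToInfiniteUnits K (Units.mk0 b hb0))) := by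
    set ε : (InfiniteAdeleRing K)ˣ := Units.map (MonoidHom.mulSingle (fun v : InfinitePlace K => v.Completion) w₀ :
      w₀.Completion →* InfiniteAdeleRing K) (-1) with hε
    have hpos : ∀ (w : InfinitePlace K) (hw : w.IsReal), 0 < InfinitePlace.Completion.extensionEmbeddingOfIsReal hw
        (((globalToInfiniteUnits K (Units.mk0 b hb0) * ε : (InfiniteAdeleRing K)ˣ) : InfiniteAdeleRing K) w) := by
      intro w hw
      change 0 < InfinitePlace.Completion.extensionEmbeddingOfIsReal hw (algebraMap K w.Completion b *
          Pi.mulSingle (M := fun v : InfinitePlace K => v.Completion) w₀ (-1 : w₀.Completion) w)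
      rw [map_mul]
      by_cases hww : w = w₀
      · subst hww
        rw [Pi.mulSingle_eq_same, map_neg, map_one]
        exact mul_pos_of_neg_of_neg hbneg (by norm_num)
      · rw [Pi.mulSingle_eq_of_ne (M := fun v : InfinitePlace K => v.Completion) hww, map_one, mul_one]
        exact hbpos w hw hww
    have h1 := artinIdeleMap_infiniteIdeles_eq_one_of_pos L _ hpos
    rw [map_mul, map_mul] at h1
    have hε' : artinIdeleMap L artinReciprocity_character_holds (infiniteIdeles K ε) = absRestrictNormalHom L c' :=
      artinIdeleMap_infiniteIdeleSingle_neg_one L hw₀ hc'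
    rw [hε'] at h1
    rw [map_inv, eq_inv_of_mul_eq_one_left h1]
  -- the reciprocity law for `x₂` over every `T ⊇ S₀`
  have hrec₂ : ∀ T : Finset (Place K), S₀ ⊆ T →
      ∑ v ∈ T, LocalInvariants.canonical K 2 v (galoisCohomology.localization (mu K 2) v 2 x₂) = 0 := by
    intro T hT
    set Tf : Finset (HeightOneSpectrum (𝓞 K)) := T.preimage Sum.inr Sum.inr_injective.injOn with hTf
    have hTdec : T = (Finset.univ : Finset (InfinitePlace K)).disjSum Tf := by
      ext v
      rcases v with w | v
      · simp only [Finset.inl_mem_disjSum, Finset.mem_univ, iff_true]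
        exact hT (hS₀inl w)
      · simp only [Finset.inr_mem_disjSum, hTf, Finset.mem_preimage]
    rw [hTdec, Finset.sum_disjSum]
    -- infinite places: only `w₀` contributes, with `1`
    have hinfsum : ∑ w : InfinitePlace K, LocalInvariants.canonical K 2 (Sum.inl w)
        (galoisCohomology.localization (mu K 2) (Sum.inl w) 2 x₂) = 1 := by
      rw [Finset.sum_eq_single w₀]
      · rw [LocalInvariants.canonical_inl, hinf₀]
      · intro w _ hne
        rw [LocalInvariants.canonical_inl]
        rcases w.isReal_or_isComplex with hw | hw
        · rw [hinf w hw hne, map_zero]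
        · exact archimedeanInvariantMap_eq_zero_of_isComplex hw _
      · intro h
        exact absurd (Finset.mem_univ w₀) h
    -- finite places: `-ψ(γ)` with `γ = c'⁻¹`
    have hram : ∀ v : HeightOneSpectrum (𝓞 K),
        (∃ σ ∈ absInertia (v.adicCompletion K), ψ (absGaloisRestrict K (v.adicCompletion K) σ) ≠ 0) →
        galoisCohomology.localization (mu K 2) (Sum.inr v) 2 (((mu K 2).tateDualPairing 2).cupProduct
          ((isSES_kummer K 2 (NeZero.pos 2)).δ₀ (baseUnitsInvariant K ((Units.mk0 b hb0 : Kˣ) : K)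
            (Units.mk0 b hb0).ne_zero))
          (oneCocycleClass _ (scalarCocycle ψ))) = 0 := by
      rintro v ⟨σ, hσ, hne⟩
      have hvQ : v ∈ Q := by
        by_contra h
        exact hne (hunr v (by rwa [← hQmem]) σ hσ)
      exact hlocQ v hvQ
    have hSf : ∀ v ∉ Tf, localInvariantMap K 2 v (galoisCohomology.localization (mu K 2) (Sum.inr v) 2
        (((mu K 2).tateDualPairing 2).cupProduct
          ((isSES_kummer K 2 (NeZero.pos 2)).δ₀ (baseUnitsInvariant K ((Units.mk0 b hb0 : Kˣ) : K)
            (Units.mk0 b hb0).ne_zero))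
          (oneCocycleClass _ (scalarCocycle ψ)))) = 0 := by
      intro v hv
      have hv' : (Sum.inr v : Place K) ∉ S₀ := fun h => hv (by rw [hTf, Finset.mem_preimage]; exact hT h)
      exact hinv0 v (hS₀inr v hv')
    have hfinsum := sum_localInvariantMap_localization_cupProduct_δ₀_eq_neg_apply L ψ hker (Units.mk0 b hb0)
      c'⁻¹ hγ hram Tf hSf
    have hψγ : ψ c'⁻¹ = 1 := by
      rw [ψ.map_inv, hconj w₀ hw₀ c' hc']
      decide
    rw [hψγ] at hfinsum
    have hfinsum' : ∑ v ∈ Tf, LocalInvariants.canonical K 2 (Sum.inr v)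
        (galoisCohomology.localization (mu K 2) (Sum.inr v) 2 x₂) = -1 := by
      rw [← hfinsum]
      exact Finset.sum_congr rfl fun v _ => by rw [LocalInvariants.canonical_inr]; rfl
    rw [hinfsum, hfinsum']
    decide
  -- the embedding `ℤ/2 ↪ ℤ/n`, `k ↦ k·(n/2)`, as an additive map
  obtain ⟨Ψ, hΨ⟩ : ∃ Ψ : ZMod 2 →+ ZMod n, ∀ k : ZMod 2, Ψ k = ((k.val * (n / 2) : ℕ) : ZMod n) := by
    refine ⟨ZMod.lift 2 ⟨zmultiplesHom (ZMod n) ((n / 2 : ℕ) : ZMod n), ?_⟩, fun k => ?_⟩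
    · rw [zmultiplesHom_apply, natCast_zsmul, nsmul_eq_mul, ← Nat.cast_mul, hn2, ZMod.natCast_self]
    · have hk : ((k.val : ℤ) : ZMod 2) = k := by rw [Int.cast_natCast, ZMod.natCast_zmod_val]
      conv_lhs => rw [← hk]
      rw [ZMod.lift_coe]
      change ((k.val : ℕ) : ℤ) • ((n / 2 : ℕ) : ZMod n) = _
      rw [natCast_zsmul, nsmul_eq_mul, Nat.cast_mul]
  have hlev : ∀ v : Place K, LocalInvariants.canonical K n v (galoisCohomology.localization (mu K n) v 2 x) =
      Ψ (LocalInvariants.canonical K 2 v (galoisCohomology.localization (mu K 2) v 2 x₂)) := by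
    intro v
    rw [hx, canonical_localization_cohomologyMap_muInclHom h2n v x₂, hΨ]
  -- outputs
  refine ⟨x, ?_, fun w hw hne => ?_, S₀, fun v hv => ?_, fun T hT => ?_⟩
  · -- the invariant at `w₀`
    rw [hx, archimedeanInvariantMap_localization_cohomologyMap_muInclHom w₀ h2n x₂, hinf₀, ZMod.val_one, one_mul]
  · -- the other real places
    exact localization_inl_cohomologyMap_muInclHom_eq_zero w h2n x₂ (hinf w hw hne)
  · -- the support
    rw [hlev, hcan0 v hv, map_zero]
  · -- the reciprocity law
    rw [Finset.sum_congr rfl fun v _ => hlev v, ← map_sum, hrec₂ T hT, map_zero]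

end Literature.NumberTheory.GaloisCohomology

end
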